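import Mathlib
import Literature.AlgebraicGeometry.Resolution.CobordantGame
import Literature.AlgebraicGeometry.Resolution.FormalCoordinateChange
import Summits.ResolutionOfSingularities.ResolutionOfSingularities.Theorems.WeightedInvariantGlobalizeLocalDropCanonize
import Summits.ResolutionOfSingularities.ResolutionOfSingularities.Theorems.WeightedInvariantGlobalizeLocalDropCylinder
import Summits.ResolutionOfSingularities.ResolutionOfSingularities.Theorems.WeightedInvariantLocalWeightedDropSeparableTerminalDoublePointsAux
import Summits.ResolutionOfSingularities.ResolutionOfSingularities.Theorems.WeightedInvariantLocalWeightedDropSeparableMonomialReduction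

/-!
# `WeightedInvariant.LocalWeightedDrop`, line `hasse-ridge-face-selection`: REDUCTION OF THE SEPARABLE char-2 DOUBLE POINTS TO THE
# PURE FORM `y² + x₀^a x₁^b · y + A₀`

Crux item stmt-ResolutionOfSingularities-8899 `LocalWeightedDrop` (route `ResolutionOfSingularities/WeightedInvariant`), serving the
door `WeightedConstruction` stmt-ResolutionOfSingularities-0571.  [OURS · L1 W4.3, chain w43, stub worker 2 (gen 2): fourth unit of the
reduction piece S2sM `stub_charTwoSeparableReductionWon` (typed sub-cut of S2s, evidence #56 on stmt-8899); NOT a statement of any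
manuscript.]

* `won_dp1_unit_iff`: scaling the distinguished variable by a unit `U` of `k[[x₀,x₁]]` (`y ↦ U·y`, a legal coordinate change, followed by
  the unit `U²`) identifies the positions `(U² A₀, U A₁)` and `(A₀, A₁)`: `y² + (U A₁) y + U² A₀` is won iff `y² + A₁ y + A₀` is.
* `sepWon_of_pureWon` (characteristic `2`, `k = k̄`; only the singular one-variable germs assumed won): IF every PURE position
  `y² + x₀^a x₁^b · y + A₀` (`a + b ≥ 2`, `ord A₀ ≥ 3`) is won THEN every separable position (`A₁ ≠ 0`) is won
  (`SepMonoReduction.sepWon_of_monomialWon` + the unit scaling `U = V`).  `charTwoSeparableReduction_of_pureWon`: the stub's shape.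
So S2sM is EQUIVALENT (the pure positions are separable positions) to: «every `y² + x₀^a x₁^b·y + A₀`, `a + b ≥ 2`, `ord A₀ ≥ 3`, is
won» — a double point whose `∂f/∂y` is a monomial; `t = y / x^{(a,b)}` turns it into the Artin–Schreier form `t² + t + A₀ / x^{2(a,b)}`.
-/

set_option linter.dupNamespace false -- mandated namespace of this single-conjunct summit

namespace Summit.ResolutionOfSingularities.ResolutionOfSingularities.Theorems

open Literature.AlgebraicGeometry.Resolution
open Literature.AlgebraicGeometry.Resolution.CobordantGame

namespace SepPureReduction

open MvPowerSeries SepTerminalDoublePoint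

variable {k : Type} [Field k]

/-- The `y`-scaling `y ↦ U♮·y` (identity on `x₀, x₁`) has zero constant terms. -/
theorem constantCoeff_scaleY (U : MvPowerSeries (Fin 2) k) (i : Fin 3) :
    constantCoeff ((fun i : Fin 3 => if i = Fin.last 2 then rename (Fin.succAboveEmb (Fin.last 2)) U * X (Fin.last 2)
      else (X i : MvPowerSeries (Fin 3) k)) i) = 0 := by
  dsimp only
  split_ifs <;> simp [constantCoeff_X]

/-- The linear part of the `y`-scaling is `diag(1, 1, U(0))`. -/
theorem linMat_scaleY (U : MvPowerSeries (Fin 2) k) :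
    FormalCoordChange.linMat (fun i : Fin 3 => if i = Fin.last 2 then rename (Fin.succAboveEmb (Fin.last 2)) U * X (Fin.last 2)
      else (X i : MvPowerSeries (Fin 3) k)) = Matrix.diagonal (fun i : Fin 3 => if i = Fin.last 2 then constantCoeff U else 1) := by
  classical
  ext i j
  simp only [FormalCoordChange.linMat, Matrix.of_apply, Matrix.diagonal_apply]
  by_cases hi : i = Fin.last 2
  · subst hi
    rw [if_pos rfl, mul_comm, X_def, coeff_monomial_mul]
    by_cases hj : Fin.last 2 = j
    · subst hj
      rw [if_pos le_rfl, if_pos rfl, if_pos rfl, tsub_self, one_mul, coeff_zero_eq_constantCoeff_apply, constantCoeff_rename]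
    · rw [if_neg hj, if_neg]
      intro h
      have h' := h (Fin.last 2)
      rw [Finsupp.single_eq_same, Finsupp.single_eq_of_ne hj] at h'
      exact absurd h' (by norm_num)
  · rw [if_neg hi, coeff_X]
    by_cases hij : i = j
    · subst hij
      rw [if_pos rfl, if_pos rfl, if_neg hi]
    · rw [if_neg hij, if_neg]
      intro h
      exact hij ((Finsupp.single_left_inj one_ne_zero).mp h).symm

/-- The `y`-scaling is a legal coordinate change when `U(0) ≠ 0`. -/
theorem isUnit_det_linMat_scaleY {U : MvPowerSeries (Fin 2) k} (hU : constantCoeff U ≠ 0) :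
    IsUnit (FormalCoordChange.linMat (fun i : Fin 3 => if i = Fin.last 2 then
      rename (Fin.succAboveEmb (Fin.last 2)) U * X (Fin.last 2) else (X i : MvPowerSeries (Fin 3) k))).det := by
  rw [linMat_scaleY, Matrix.det_diagonal]
  refine isUnit_iff_ne_zero.mpr (Finset.prod_ne_zero_iff.mpr fun i _ => ?_)
  split_ifs
  · exact hU
  · exact one_ne_zero

/-- THE `y`-SCALING ON A MONIC DOUBLE POINT: `(y ↦ U♮ y)^* (y² + (U A₁)♮ y + (U² A₀)♮) = U♮² · (y² + A₁♮ y + A₀♮)`. -/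
theorem subst_scaleY_dp1 (U A₀ A₁ : MvPowerSeries (Fin 2) k) :
    subst (fun i : Fin 3 => if i = Fin.last 2 then rename (Fin.succAboveEmb (Fin.last 2)) U * X (Fin.last 2)
        else (X i : MvPowerSeries (Fin 3) k))
      (X (Fin.last 2) ^ 2 + (rename (Fin.succAboveEmb (Fin.last 2)) (U ^ 2 * A₀) +
        rename (Fin.succAboveEmb (Fin.last 2)) (U * A₁) * X (Fin.last 2))) =
      rename (Fin.succAboveEmb (Fin.last 2)) U ^ 2 *
        (X (Fin.last 2) ^ 2 + (rename (Fin.succAboveEmb (Fin.last 2)) A₀ +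
          rename (Fin.succAboveEmb (Fin.last 2)) A₁ * X (Fin.last 2))) := by
  have h0 := constantCoeff_scaleY (k := k) U
  have hs := hasSubst_of_constantCoeff_zero h0
  have hren : ∀ A : MvPowerSeries (Fin 2) k, subst (fun i : Fin 3 => if i = Fin.last 2 then
      rename (Fin.succAboveEmb (Fin.last 2)) U * X (Fin.last 2) else (X i : MvPowerSeries (Fin 3) k))
      (rename (Fin.succAboveEmb (Fin.last 2)) A) = rename (Fin.succAboveEmb (Fin.last 2)) A := by
    intro A
    have hF : (fun i : Fin 2 => (fun i : Fin 3 => if i = Fin.last 2 then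
        rename (Fin.succAboveEmb (Fin.last 2)) U * X (Fin.last 2) else (X i : MvPowerSeries (Fin 3) k))
        ((Fin.succAboveEmb (Fin.last 2)) i)) = X ∘ ⇑(Fin.succAboveEmb (Fin.last 2)) := by
      funext i
      simp only [Function.comp_apply]
      rw [if_neg]
      exact (Fin.succAbove_ne (Fin.last 2) i)
    rw [subst_rename_eq _ _ h0 A, hF, ← rename_eq_subst]
  rw [← coe_substAlgHom hs]
  simp only [map_add, map_mul, map_pow]
  rw [coe_substAlgHom, subst_X hs, if_pos rfl, hren, hren, hren]
  ring

/-- UNIT SCALING OF THE DISTINGUISHED VARIABLE DOES NOT CHANGE WINNABILITY: for a unit `U` of `k[[x₀,x₁]]`,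
`y² + (U A₁) y + U² A₀` is won iff `y² + A₁ y + A₀` is (`y ↦ U y` is legal, then divide by the unit `U²`). -/
theorem won_dp1_unit_iff {U : MvPowerSeries (Fin 2) k} (hU : constantCoeff U ≠ 0) (A₀ A₁ : MvPowerSeries (Fin 2) k) :
    CobordantGame.Won k 3 (X (Fin.last 2) ^ 2 + (rename (Fin.succAboveEmb (Fin.last 2)) (U ^ 2 * A₀) +
        rename (Fin.succAboveEmb (Fin.last 2)) (U * A₁) * X (Fin.last 2))) ↔
      CobordantGame.Won k 3 (X (Fin.last 2) ^ 2 + (rename (Fin.succAboveEmb (Fin.last 2)) A₀ +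
        rename (Fin.succAboveEmb (Fin.last 2)) A₁ * X (Fin.last 2))) := by
  rw [← won_subst_iff (constantCoeff_scaleY U) (isUnit_det_linMat_scaleY hU) _, subst_scaleY_dp1]
  refine won_unit_mul_iff ?_ _
  rw [map_pow, constantCoeff_rename]
  exact pow_ne_zero _ hU

/-- REDUCTION TO THE PURE FORM (characteristic `2`, `k = k̄`; only the singular one-variable germs assumed won): if every PURE
position `y² + x₀^a x₁^b · y + A₀` (`a + b ≥ 2`, `ord A₀ ≥ 3`) is won, then every separable position is won. -/
theorem sepWon_of_pureWon [CharP k 2] [IsAlgClosed k]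
    (hlow : ∀ g : MvPowerSeries (Fin 1) k, CobordantGame.IsSingular k g → CobordantGame.Won k 1 g)
    (hPure : ∀ (A₀ : MvPowerSeries (Fin 2) k) (a b : ℕ), (2 : ℕ∞) < A₀.order → 2 ≤ a + b →
      CobordantGame.Won k 3 (X (Fin.last 2) ^ 2 + (rename (Fin.succAboveEmb (Fin.last 2)) A₀ +
        rename (Fin.succAboveEmb (Fin.last 2)) (X 0 ^ a * X 1 ^ b) * X (Fin.last 2)))) :
    ∀ A₀ A₁ : MvPowerSeries (Fin 2) k, (2 : ℕ∞) < A₀.order → (1 : ℕ∞) < A₁.order → A₁ ≠ 0 →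
      CobordantGame.Won k 3 (X (Fin.last 2) ^ 2 + (rename (Fin.succAboveEmb (Fin.last 2)) A₀ +
        rename (Fin.succAboveEmb (Fin.last 2)) A₁ * X (Fin.last 2))) := by
  refine SepMonoReduction.sepWon_of_monomialWon hlow fun A₀ V a b h₀ hab hV => ?_
  -- `A₀ = V² · (V⁻² A₀)`, `x^a x^b V = V · x^a x^b`
  have hVinv : V * V⁻¹ = 1 := MvPowerSeries.mul_inv_cancel V hV
  have hA₀ : A₀ = V ^ 2 * (V⁻¹ ^ 2 * A₀) := by
    rw [← mul_assoc, ← mul_pow, hVinv, one_pow, one_mul]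
  rw [hA₀, show X 0 ^ a * X 1 ^ b * V = V * (X 0 ^ a * X 1 ^ b) by ring, won_dp1_unit_iff hV]
  refine hPure _ a b ?_ hab
  exact lt_of_lt_of_le h₀ (le_trans le_add_self le_order_mul)

end SepPureReduction

open SepPureReduction MvPowerSeries in
/-- S2sM REDUCED TO THE PURE FORM (in the quantifier shape of the proposed stub `stub_charTwoSeparableReductionWon`, evidence #56 on
stmt-8899).  Over an algebraically closed field of characteristic `2`, given the singular germs in `≤ 2` variables: if every monic germ
`y² + x₀^a x₁^b · y + A₀` (`a + b ≥ 2`, `ord A₀ ≥ 3`) is won, then every monic germ `y² + A₁ y + A₀` with `ord A₀ ≥ 3`, `ord A₁ ≥ 2`,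
`A₁ ≠ 0` is won.  [OURS · L1 W4.3: the embedded resolution of the discriminant curve `A₁ = 0`, the coordinate change making its
normal-crossing support literal, and the unit scaling of `y` are kernel theorems; the residual «pure» class is the separable analogue of
the purely inseparable equation `y² + A₀` of Hauser–Perlega.] -/
theorem charTwoSeparableReduction_of_pureWon (k : Type) [Field k] [CharP k 2] [IsAlgClosed k]
    (hlow : ∀ m : ℕ, m < 3 → ∀ g : MvPowerSeries (Fin m) k, CobordantGame.IsSingular k g → CobordantGame.Won k m g)
    (hPure : ∀ (A₀ : MvPowerSeries (Fin 2) k) (a b : ℕ), (2 : ℕ∞) < A₀.order → 2 ≤ a + b →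
      CobordantGame.Won k 3 (MvPowerSeries.X (Fin.last 2) ^ 2 + (MvPowerSeries.rename (Fin.succAboveEmb (Fin.last 2)) A₀ +
        MvPowerSeries.rename (Fin.succAboveEmb (Fin.last 2)) (MvPowerSeries.X 0 ^ a * MvPowerSeries.X 1 ^ b) *
          MvPowerSeries.X (Fin.last 2)))) :
    ∀ A₀ A₁ : MvPowerSeries (Fin 2) k, (2 : ℕ∞) < A₀.order → (1 : ℕ∞) < A₁.order → A₁ ≠ 0 →
      CobordantGame.Won k 3 (MvPowerSeries.X (Fin.last 2) ^ 2 + (MvPowerSeries.rename (Fin.succAboveEmb (Fin.last 2)) A₀ +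
        MvPowerSeries.rename (Fin.succAboveEmb (Fin.last 2)) A₁ * MvPowerSeries.X (Fin.last 2))) :=
  sepWon_of_pureWon (hlow 1 (by norm_num)) hPure

end Summit.ResolutionOfSingularities.ResolutionOfSingularities.Theorems
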